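import Mathlib
import Literature.MathematicalPhysics.QuantumFieldTheory.Balaban1983to89.B9BlockSystemCubes

/-! # `Balaban1983to89.B9BlockSystemSigma` — B9 (3.18): the MULTI-LEVEL block system 𝔅 = ⋃_j Λ_j (blocks of order j on
Λ_j) as a DISJOINT UNION of block systems; `IsBlockSystem` is stable under enlarging the bond set and under disjoint
unions over levels, so the multi-level cube geometry is an `IsBlockSystem` and carries the chain (3.17) → (3.25) +
Thm 3.11 «obvious» hypothesis-free, kernel-checked

CITATION HEADER.  Paper sub-cell `b2b-balaban-b09` (gen 6, journal claim SHARPEN T06.1 (3.18) multi-level block system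
𝔅 = ⋃_j Λ_j: sigma/mono combinators for IsBlockSystem pass 16 ∕ C-B9-37-SIGMA-LEVELS, cell pub-balaban) on T. Balaban,
*Propagators for lattice gauge theories in a background field*, Commun. Math. Phys. 99 (1985) 389–434
[`Balaban1985BackgroundPropagators`] (= B9), p. 393 [PDF 5] (render `b2b-balaban-ref1/pages/1985-cmp99-background-
propagators/…-p005-x2.png`, read as image in passes 5–13 of this lineage), with [5] = *Averaging operations for lattice
gauge theories*, Commun. Math. Phys. 98 (1985) 17–51 [`Balaban1985Averaging`] (= B7), p. 17, (2)–(3).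

WHAT IS PRINTED (verbatim, B9 p. 393).
* *"Now let us define a sequence of domains Ω_j ⊂ T^{(j)}, j = 1, …, k, such that Ω_j ⊃ B(Ω_{j+1}) … Next we define
  Λ_j = Ω_j^{(j)}∖Ω_{j+1}^{(j)}, j = 0,1,…,k, Ω_{k+1} = ∅, or Ω_j∖Ω_{j+1} = B^j(Λ_j), hence Λ_j ⊂ T^{(j)}_{L^jη}."*
* (3.18): *"where Q′λ is defined on 𝔅 = ⋃_{j=0}^{k} Λ_j by the formulas (Q′λ)(y) = (Q′_j(U)λ)(y) for y∈Λ_j, (3.18)"*;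
  (3.19): *"(Q′_j(U)λ)(y) = … = Σ_{x∈B^j(y)} L^{−jd}R(U(Γ^{(j)}_{y,x}))λ(x), y∈T^{(j)}_{L^jη}. (3.19)"*.
* B7 p. 17, (3): *"For a subset Λ ⊂ L^jηZ^d (or ⊂ δZ^d), we define B^j(Λ) = ⋃_{y∈Λ} B^j(y)"*.

WHY THIS FILE.  Passes 14–15 (`B9BlockSystem1D`, `B9BlockSystemCubes`) instantiate pass 12's structural bundle
`IsBlockSystem` for ONE level: cubes of a fixed side.  (3.18) glues LEVELS: the set of centres is the disjoint union
𝔅 = ⋃_j Λ_j and the fine domain is the disjoint union Ω₀ = ⋃_j B^j(Λ_j) of cubes of order j (side L^j, weight L^{−jd}).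
Structurally this is a Σ-type (dependent disjoint union) of block systems, and the lattice Laplacian of (3.21)–(3.24)
uses MORE bonds than the contours do (inter-cube and inter-level bonds).  THIS FILE proves the two closure properties
that make passes 12–15 apply to that shape: `isBlockSystem_mono` (enlarging the bond set preserves a block system —
chains stay chains) and `isBlockSystem_sigma` (the disjoint union over any finite index type J of block systems on
(X_j, Y_j) is a block system on (Σ_j X_j, Σ_j Y_j), with `sigBonds`/`sigW`/`sigB`/`sigΓ`/`sigY`); corollary
`isBlockSystem_levels`: the multi-level cube geometry (level j ∈ J: the d-dimensional cube system of pass 15 with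
M_j^d cubes of side l_j + 1 — print: l_j + 1 = L^j) with ANY bond set containing the intra-cube bonds is an
`IsBlockSystem`; hence (`obvious_311_levels`) Thm 3.11 «obvious» / (3.25) `Data` on it with no structural hypothesis.
NOT asserted: the geometric placement of the regions Λ_j inside one torus T_η and the inter-level bonds themselves (any
finite bond set ⊇ intra-cube bonds is allowed; the kernel/positivity statements only get stronger with more bonds).
[folklore]; value = kernel-checked bookkeeping, NOT summit progress.  Cell records: GAPS C-B9-37, DIVERGENCE D-b09.28. -/

namespace Literature.MathematicalPhysics.QuantumFieldTheory.Balaban1983to89.B9BlockSystemSigma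

open B9Eq323Ker B9Eq319Onto B9Thm311Lattice B9Eq325Proj B9Thm311Data B9BlockSystem1D B9BlockSystemCubes
open scoped InnerProductSpace

/-! ## §1  Enlarging the bond set -/

section Mono

variable {X Y : Type*}

/-- **A block system stays a block system when bonds are ADDED** (the contours are chains in any larger bond set).
[cite: Balaban1985BackgroundPropagators, (3.18)-(3.19) p.393, (3.21) p.394] -/
theorem isBlockSystem_mono {bonds bonds' : Finset (X × X)} (hsub : bonds ⊆ bonds') {w : Y → X → ℝ}
    {B : Y → Finset X} {Γ : Y → X → List X} {y : Y → X} (h : IsBlockSystem bonds w B Γ y) :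
    IsBlockSystem bonds' w B Γ y where
  chain c x hx := (h.chain c x hx).imp fun _ _ hb => hsub hb
  last := h.last
  sum_ne := h.sum_ne
  cover := h.cover
  centre_mem := h.centre_mem
  centre_path := h.centre_path
  centre_wt := h.centre_wt
  disj := h.disj

end Mono

/-! ## §2  Disjoint union over levels (Σ-types) -/

section Sigma

variable {J : Type*} {X Y : J → Type*}

/-- Level-wise weights: w(⟨j,c⟩, ⟨j,x⟩) = w_j(c,x), and 0 across levels. [cite: Balaban1985BackgroundPropagators, (3.18) p.393] -/
def sigW [DecidableEq J] (w : ∀ j, Y j → X j → ℝ) : (Σ j, Y j) → (Σ j, X j) → ℝ :=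
  fun c x => if h : x.1 = c.1 then w c.1 c.2 (h ▸ x.2) else 0

/-- Level-wise blocks B(⟨j,c⟩) = {j} × B_j(c). [cite: Balaban1985BackgroundPropagators, (3.18)-(3.19) p.393] -/
def sigB (B : ∀ j, Y j → Finset (X j)) : (Σ j, Y j) → Finset (Σ j, X j) :=
  fun c => (B c.1 c.2).map (Function.Embedding.sigmaMk c.1)

/-- Level-wise contours Γ(⟨j,c⟩, ⟨j,x⟩) = Γ_j(c,x) (empty across levels).
[cite: Balaban1985BackgroundPropagators, (3.19) p.393] -/
def sigΓ [DecidableEq J] (Γ : ∀ j, Y j → X j → List (X j)) : (Σ j, Y j) → (Σ j, X j) → List (Σ j, X j) :=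
  fun c x => if h : x.1 = c.1 then (Γ c.1 c.2 (h ▸ x.2)).map (Sigma.mk c.1) else []

/-- Level-wise centres y(⟨j,c⟩) = ⟨j, y_j(c)⟩. [cite: Balaban1985BackgroundPropagators, (3.18) p.393] -/
def sigY (y : ∀ j, Y j → X j) : (Σ j, Y j) → (Σ j, X j) := fun c => ⟨c.1, y c.1 c.2⟩

/-- The union over levels of the level bond sets. [folklore] -/
def sigBonds [Fintype J] [DecidableEq J] [∀ j, DecidableEq (X j)] (bonds : ∀ j, Finset (X j × X j)) :
    Finset ((Σ j, X j) × (Σ j, X j)) :=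
  Finset.univ.biUnion fun j =>
    (bonds j).map ((Function.Embedding.sigmaMk j).prodMap (Function.Embedding.sigmaMk (β := X) j))

/-- `sigW` inside a level. [folklore] -/
theorem sigW_mk [DecidableEq J] (w : ∀ j, Y j → X j → ℝ) (j : J) (c : Y j) (x : X j) : sigW w ⟨j, c⟩ ⟨j, x⟩ = w j c x := by
  simp [sigW]

/-- `sigΓ` inside a level. [folklore] -/
theorem sigΓ_mk [DecidableEq J] (Γ : ∀ j, Y j → X j → List (X j)) (j : J) (c : Y j) (x : X j) :
    sigΓ Γ ⟨j, c⟩ ⟨j, x⟩ = (Γ j c x).map (Sigma.mk j) := by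
  simp [sigΓ]

/-- Membership in a level-wise block. [folklore] -/
theorem mem_sigB (B : ∀ j, Y j → Finset (X j)) (j : J) (c : Y j) (x : Σ j, X j) :
    x ∈ sigB B ⟨j, c⟩ ↔ ∃ x₀ ∈ B j c, (⟨j, x₀⟩ : Σ j, X j) = x := by
  simp [sigB]

/-- A level bond is a bond of the union. [folklore] -/
theorem mem_sigBonds_of_mem [Fintype J] [DecidableEq J] [∀ j, DecidableEq (X j)] (bonds : ∀ j, Finset (X j × X j)) (j : J)
    {a b : X j} (h : (a, b) ∈ bonds j) : ((⟨j, a⟩ : Σ j, X j), (⟨j, b⟩ : Σ j, X j)) ∈ sigBonds bonds := by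
  rw [sigBonds, Finset.mem_biUnion]
  exact ⟨j, Finset.mem_univ _, Finset.mem_map.mpr ⟨(a, b), h, rfl⟩⟩

/-- **The disjoint union over levels of block systems is a block system.**
[cite: Balaban1985BackgroundPropagators, (3.18)-(3.19) p.393] -/
theorem isBlockSystem_sigma [Fintype J] [DecidableEq J] [∀ j, DecidableEq (X j)] {bonds : ∀ j, Finset (X j × X j)}
    {w : ∀ j, Y j → X j → ℝ} {B : ∀ j, Y j → Finset (X j)} {Γ : ∀ j, Y j → X j → List (X j)}
    {y : ∀ j, Y j → X j} (h : ∀ j, IsBlockSystem (bonds j) (w j) (B j) (Γ j) (y j)) :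
    IsBlockSystem (sigBonds bonds) (sigW w) (sigB B) (sigΓ Γ) (sigY y) where
  chain c x hx := by
    obtain ⟨j, c⟩ := c
    obtain ⟨x₀, hx₀, rfl⟩ := (mem_sigB B j c x).mp hx
    rw [sigΓ_mk]
    show List.IsChain _ (((y j c) :: Γ j c x₀).map (Sigma.mk j))
    rw [List.isChain_map]
    exact ((h j).chain c x₀ hx₀).imp fun _ _ hb => mem_sigBonds_of_mem bonds j hb
  last c x hx := by
    obtain ⟨j, c⟩ := c
    obtain ⟨x₀, hx₀, rfl⟩ := (mem_sigB B j c x).mp hx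
    have e : sigY y ⟨j, c⟩ :: sigΓ Γ ⟨j, c⟩ ⟨j, x₀⟩ = ((y j c) :: Γ j c x₀).map (Sigma.mk j) := by
      rw [sigΓ_mk]; rfl
    simp only [e, List.getLast_map, (h j).last c x₀ hx₀]
  sum_ne c := by
    obtain ⟨j, c⟩ := c
    show ∑ x ∈ (B j c).map (Function.Embedding.sigmaMk j), sigW w ⟨j, c⟩ x ≠ 0
    rw [Finset.sum_map]
    simp only [Function.Embedding.sigmaMk_apply, sigW_mk]
    exact (h j).sum_ne c
  cover x := by
    obtain ⟨j, x₀⟩ := x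
    obtain ⟨c, hc⟩ := (h j).cover x₀
    exact ⟨⟨j, c⟩, (mem_sigB B j c _).mpr ⟨x₀, hc, rfl⟩⟩
  centre_mem c := by
    obtain ⟨j, c⟩ := c
    exact (mem_sigB B j c _).mpr ⟨y j c, (h j).centre_mem c, rfl⟩
  centre_path c := by
    obtain ⟨j, c⟩ := c
    show sigΓ Γ ⟨j, c⟩ ⟨j, y j c⟩ = []
    rw [sigΓ_mk, (h j).centre_path c, List.map_nil]
  centre_wt c := by
    obtain ⟨j, c⟩ := c
    show sigW w ⟨j, c⟩ ⟨j, y j c⟩ ≠ 0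
    rw [sigW_mk]
    exact (h j).centre_wt c
  disj c c' hne hmem := by
    obtain ⟨j, c⟩ := c
    obtain ⟨j', c'⟩ := c'
    obtain ⟨x₀, hx₀, hxe⟩ := (mem_sigB B j c _).mp hmem
    change (⟨j, x₀⟩ : Σ j, X j) = ⟨j', y j' c'⟩ at hxe
    obtain ⟨hjj, hhx⟩ := Sigma.mk.inj_iff.mp hxe
    subst hjj
    have hx : x₀ = y j c' := eq_of_heq hhx
    subst hx
    have hcc : c ≠ c' := fun e => hne (by rw [e])
    exact (h j).disj c c' hcc hx₀

end Sigma

/-! ## §3  The multi-level cube geometry of (3.18) -/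

section Levels

variable {J : Type*} (d : ℕ) (M l : J → ℕ)

/-- The sites of the multi-level cube geometry: level j has M_j^d cubes of side l_j + 1 in d dimensions.
[cite: Balaban1985BackgroundPropagators, (3.18) p.393] -/
abbrev LSite := Σ j : J, (Fin d → Fin (M j)) × (Fin d → Fin (l j + 1))

/-- The centres 𝔅 = ⋃_j Λ_j of the multi-level cube geometry. [cite: Balaban1985BackgroundPropagators, (3.18) p.393] -/
abbrev LCentre := Σ j : J, (Fin d → Fin (M j))

variable [Fintype J] [DecidableEq J]

/-- **The multi-level cube geometry of (3.18) is a block system, for any bond set containing the intra-cube bonds of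
all levels.** [cite: Balaban1985BackgroundPropagators, (3.18)-(3.19) p.393; Balaban1985Averaging, (2)-(3) p.17] -/
theorem isBlockSystem_levels (bonds' : Finset (LSite d M l × LSite d M l))
    (hsub : sigBonds (fun j => bondsC d (M j) (l j)) ⊆ bonds') :
    IsBlockSystem bonds' (sigW fun j => wtC d (M j) (l j)) (sigB fun j => blockC d (M j) (l j))
      (sigΓ fun j => pathC d (M j) (l j)) (sigY fun j => centreC d (M j) (l j)) :=
  isBlockSystem_mono hsub (isBlockSystem_sigma fun j => isBlockSystem_cubes d (M j) (l j))

variable {V : Type*} [NormedAddCommGroup V] [InnerProductSpace ℝ V] [FiniteDimensional ℝ V]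

/-- **Thm 3.11 «obvious for the first three operators» / (3.25) `Data` on the multi-level cube geometry of (3.18),
hypothesis-free** (any finite bond set ⊇ intra-cube bonds with positive weights, a_c > 0, injective transports).
[cite: Balaban1985BackgroundPropagators, Thm 3.11 p.416, (3.18) p.393, (3.24)-(3.25) p.394] -/
theorem obvious_311_levels (τ : LSite d M l → LSite d M l → V →ₗ[ℝ] V) (hinj : ∀ x x', Function.Injective (τ x x'))
    (bonds' : Finset (LSite d M l × LSite d M l)) (hsub : sigBonds (fun j => bondsC d (M j) (l j)) ⊆ bonds')
    (cb : LSite d M l × LSite d M l → ℝ) (hcb : ∀ b ∈ bonds', 0 < cb b) (a : LCentre d M → ℝ) (ha : ∀ c, 0 < a c) :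
    ∃ (g : PiLp 2 (fun _ : LSite d M l => V) →ₗ[ℝ] PiLp 2 (fun _ : LSite d M l => V))
      (c : PiLp 2 (fun _ : LCentre d M => V) →ₗ[ℝ] PiLp 2 (fun _ : LCentre d M => V)),
      B9Eq325Proj.Data (lapL τ bonds' cb)
          (qL τ (sigW fun j => wtC d (M j) (l j)) (sigB fun j => blockC d (M j) (l j))
            (sigΓ fun j => pathC d (M j) (l j)) (sigY fun j => centreC d (M j) (l j)))
          (LinearMap.adjoint (qL τ (sigW fun j => wtC d (M j) (l j)) (sigB fun j => blockC d (M j) (l j))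
            (sigΓ fun j => pathC d (M j) (l j)) (sigY fun j => centreC d (M j) (l j)))) (AL a) g c ∧
        PosDef (lapA (lapL τ bonds' cb)
          (qL τ (sigW fun j => wtC d (M j) (l j)) (sigB fun j => blockC d (M j) (l j))
            (sigΓ fun j => pathC d (M j) (l j)) (sigY fun j => centreC d (M j) (l j)))
          (LinearMap.adjoint (qL τ (sigW fun j => wtC d (M j) (l j)) (sigB fun j => blockC d (M j) (l j))
            (sigΓ fun j => pathC d (M j) (l j)) (sigY fun j => centreC d (M j) (l j)))) (AL a)) ∧
        PosDef g ∧ PosDef c ∧ (∀ f f', ⟪g f, f'⟫_ℝ = ⟪f, g f'⟫_ℝ) ∧ (∀ φ ψ, ⟪c φ, ψ⟫_ℝ = ⟪φ, c ψ⟫_ℝ) :=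
  obvious_311_lattice τ hinj cb hcb (isBlockSystem_levels d M l bonds' hsub) a ha

end Levels

end Literature.MathematicalPhysics.QuantumFieldTheory.Balaban1983to89.B9BlockSystemSigma
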